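import Summits.ABC.IUTFork.Cor312LicenceShallowMultiSlot
import HarnessLib

/-!
# [IUTchIII] Cor. 3.12 — the (xi-f) inclusion from (Ind1)-PERMUTED images: movers on all capsule slots AFTER a slot permutation
# (the Θ-idele moved to an arbitrary slot), and the per-summand slot choice

PROOF-ONLY support piece (D-0012; 0 definitions, 0 `Prop` facts) of the abc-iut cell (WAVE-4 D-0067 cone-interior prover
abc-iut-w4-d006, gen 5; row «MIXED-SUMMAND», positive half). TAKES NO SIDE on [IUTchIII] Cor. 3.12 (S. Mochizuki,
*Inter-universal Teichmüller theory III*, kurims manuscript, Cor. 3.12 p. 173 l. 41 – p. 174 l. 19; Step (xi-f) p. 184 l. 26–29;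
Thm. 3.11 (i) (Ind1)/(Ind2) p. 154) or on any author: statements about OUR typed objects (abc-iut-c312-1's `LogShells.Ind1`/`Ind2`
families of `Thm311Sig`/`Thm311Multirad`, abc-iut-c312-5's `logShellsDH` / `PadicPresentation`, abc-iut-c312-3's sharp setting
`settingDHVolSharp`); the per-packet hull reading is a STRONGER-THAN-PRINT form (referee lanes A1/A2); nothing here bears on the printed
GLOBAL inequality. typed ≠ proved; instantiated ≠ endorsed.

CONTEXT. abc-iut-w5-d180's frame lemma `qRegion_subset_thetaHull_settingDHVolSharp_of_slotMovers` (p439967) feeds the hull ONE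
possible image: an (Ind2)-family applied to the point `1 ⊗ ⋯ ⊗ 1 ⊗ t_{Θ,j,v_j}` of the Θ-region — the Θ-idele always in the LAST
capsule slot. The indeterminacy group of abc-iut-c312-1's typing is generated by (Ind1) ∪ (Ind2), and (Ind1) at label `j` contains
the PERMUTATIONS of the `j+1` tensor factors (`LogShells.Ind1`, `permute_tprod`; for `logShellsDH` the strip automorphisms are
trivial, `stripAutDH = {id}`). Composing a permutation `σ` with an (Ind2)-family puts the Θ-idele of the summand `v⃗` into the slot
`σ(last)` — at the place `v_{σ(last)}` — before the slot-wise movers act. At summands mixing places of different ramification over one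
prime this is a genuinely larger supply of images (part 2 of «MIXED-SUMMAND», `Cor312LicenceMixedSummand`, shows the refuted side reads
exactly the minimum over these images).

WHAT IS PROVED (namespace `Summit.ABC.IUTFork.Thm311.Real`):
* **`qRegion_subset_thetaHull_settingDHVolSharp_of_permSlotMovers`** — per summand `v⃗` a permutation `σ_{v⃗}` of `S^±_{j+1}` and
  movers `g_{a,x} ∈ Real.ismDH logv x` with `‖t_{q,v_j}‖ ≤ Π_a ‖g_{a,v_a}(slot value)‖`, the slot values being those of the
  σ-PERMUTED point (`t_{Θ,j,v_a}` on the slot `a = σ(last)`, `1` elsewhere) ⇒ `q-region ⊆ ⁿ˒°𝒰_{j,p}`. The image used at `v⃗` is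
  `Φ₂(Φ_σ(x₀))` with `Φ_σ ∈ Ind1Family` (`permute σ` at label `j`, identity at the other labels) and `Φ₂ ∈ Ind2Family`; `Φ₂·Φ_σ`
  lies in abc-iut-c312-2's `Setting.indGroup` (closure of `Ind1Family ∪ Ind2Family`).
* **`qRegion_subset_thetaHull_settingDHVolSharp_of_permTargets`** — two target functions `R_x` (a mover of `1`) and `N_x` (a mover of
  `t_{Θ,j,x}`) and a SLOT CHOICE `s(v⃗)`: if `‖t_{q,v_j}‖ ≤ N_{v_{s(v⃗)}}·Π_{a ≠ s(v⃗)} R_{v_a}` at every tuple then `q-region ⊆ ⁿ˒°𝒰_{j,p}`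
  (abc-iut-w5-d180's `…_of_targets` is the constant choice `s = last`).
HONEST SCOPE: OUR sharp containers (Θ-regions constant in `m`), Dupuy–Hilado's typed (Ind1)/(Ind2) acting independently on every
(capsule slot, place) as abc-iut-c312-1 typed Thm. 3.11 (i); STRONGER-THAN-PRINT hull reading; nothing about the author's intended hull,
the M-level `Ism`, or the printed GLOBAL inequality. [cite: Mochizuki2012, IUTchIII Thm. 3.11 (i) p. 154, Cor. 3.12 p. 173–174]
[cite: DupuyHilado2025, §3.9, §4.7, §4.9] [claim: Mochizuki2012, status: disputed] for every IUT sentence quoted.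
-/

noncomputable section

open Set Function
open scoped Pointwise

namespace Summit.ABC.IUTFork.Thm311.Real

open Cor312 Cor312.Setting Cor312Vol Literature.IUT.LogThetaLattice Literature.IUT.LogVolume NumberField IsDedekindDomain
open Literature.NumberTheory.NumberFields Literature.NumberTheory.GaloisRepresentations.Ultrametric

variable {F : Type} [Field F] [NumberField F] (X : PilotData F) {logv : PadicLogs F} (hlog : LogvAnalytic logv)
  (M : Type) [Field M] [NumberField M]
  (archPk : ∀ (j : (thetaIndex X).Label) (vQ : (thetaIndex X).VQ), Set ((logShellsDH X logv).Packet j vQ))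
  (archSub : ∀ (j : (thetaIndex X).Label) (v : (thetaIndex X).V),
    Set ((logShellsDH X logv).Packet j ((thetaIndex X).over v)))
  (Ψ : ℤ → ∀ v : (thetaIndex X).V, v ∈ (thetaIndex X).Vbad → Set ((logShellsDH X logv).StarPacket v))
  (act : ℤ → ∀ v : (thetaIndex X).V, v ∈ (thetaIndex X).Vbad →
    (logShellsDH X logv).StarPacket v → Module.End ℚ ((logShellsDH X logv).StarPacket v))
  (Mmod : ℤ → ∀ j : (thetaIndex X).LabelStar, Set ((logShellsDH X logv).GlobalPacket j.1))
  (region : ℤ → ∀ j : (thetaIndex X).LabelStar, FinDivisor M → ∀ vQ : (thetaIndex X).VQ,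
    Set ((logShellsDH X logv).Packet j.1 vQ))
  (n : ℤ) {HT : Type} {LogLink : HT → HT → Type} {IsFull : ∀ {s t : HT}, LogLink s t → Prop}
  (lat : LGPGaussianLogThetaLattice LogLink IsFull)
  {Frd : Type} {IsoF : Frd → Frd → Type} {Ob : Frd → Type} {realify : Frd → Frd} {Strip : Type}
  {IsoS : Strip → Strip → Type} {Mv : ∀ v : (thetaIndex X).V, v ∈ (thetaIndex X).Vbad → Type}
  [∀ v h, Monoid (Mv v h)]
  (sig : GlobalLGPFrobenioidSignature (thetaIndex X).lstar (thetaIndex X).V (· ∈ (thetaIndex X).Vbad)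
    Frd IsoF Ob realify Strip IsoS Mv)
  (split : SplittingMonoids Mv) {ObΔ : Type} {N : ∀ v : (thetaIndex X).V, v ∈ (thetaIndex X).Vbad → Type}
  [∀ v h, Monoid (N v h)] (qData : QPilotData ObΔ N)
  (tq : ∀ (pp : Nat.Primes) (x : (thetaIndex X).Fibre (.inr pp)), haveI : Fact (pp : ℕ).Prime := ⟨pp.2⟩; kOf X pp.1 x)
  (t : ∀ (pp : Nat.Primes) (_ : Fin X.lstar) (x : (thetaIndex X).Fibre (.inr pp)),
    haveI : Fact (pp : ℕ).Prime := ⟨pp.2⟩; kOf X pp.1 x)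
  (htq0 : ∀ pp x, tq pp x ≠ 0)
  (htq1 : ∀ (pp : Nat.Primes) (x : (thetaIndex X).Fibre (.inr pp)),
    haveI : Fact (pp : ℕ).Prime := ⟨pp.2⟩; placeOf X pp.1 x ∉ X.S → ‖tq pp x‖ = 1)

/-! ## 1. Movers on all slots after a slot permutation -/

/-- **q-REGION ⊆ Θ-HULL AT `(j, p)` FROM (Ind1)-PERMUTED (Ind2)-MOVED POINTS.** For every summand `v⃗` let a permutation `σ_{v⃗}` of
`S^±_{j+1}` and movers `g_{a,x} ∈ Real.ismDH logv x` (every slot `a`, every place `x | p`) be given such that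
`‖t_{q,v_j}‖ ≤ Π_a ‖g_{a,v_a}(y_a)‖`, where `y_a` is the value on slot `a` of the σ-PERMUTED Θ-point: `t_{Θ,j,v_a}` if `a = σ(last)`, else
`1` (`labelIdele`; `t_{Θ,0,x} := 1`). Then the q-pilot region at `(j, p)` lies in `ⁿ˒°𝒰_{j,p}`: the image `Φ₂(Φ_σ(1 ⊗ ⋯ ⊗ 1 ⊗ t_Θ))`,
`Φ_σ ∈ Ind1Family` (factor permutation at label `j`), `Φ₂ ∈ Ind2Family`, is a possible image and its `(v⃗, ι)`-coordinate has norm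
`Π_a ‖g_{a,v_a}(y_a)‖`. (abc-iut-w5-d180's `…_of_slotMovers`, p439967, is `σ = 1` at every summand.)
[cite: Mochizuki2012, IUTchIII Thm. 3.11 (i) p. 154] [cite: DupuyHilado2025, §3.9, §4.7, §4.9] [claim: Mochizuki2012, status: disputed] -/
theorem qRegion_subset_thetaHull_settingDHVolSharp_of_permSlotMovers (j : (thetaIndex X).Label) (pp : Nat.Primes)
    (hmov : haveI : Fact (pp : ℕ).Prime := ⟨pp.2⟩
      ∀ e : (thetaIndex X).Caps j → (thetaIndex X).Fibre (.inr pp),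
        ∃ (σ : Equiv.Perm ((thetaIndex X).Caps j))
          (g : (thetaIndex X).Caps j → ∀ x : (thetaIndex X).Fibre (.inr pp),
            (logShellsDH X logv).carrier x.1 ≃ₗ[ℚ] (logShellsDH X logv).carrier x.1),
          (∀ a x, g a x ∈ ismDH logv x.1) ∧
          ‖tq pp (e (Fin.last _))‖ ≤
            ∏ a, ‖(presAt X hlog pp).φ (e a) (g a (e a) (((presAt X hlog pp).φ (e a)).symm
              (Pi.mulSingle (M := fun _ : (thetaIndex X).Caps j => (presAt X hlog pp).k (e a)) (Fin.last _)
                (labelIdele X t pp j (e a)) (σ.symm a))))‖) :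
    (settingDHVolSharp X hlog M archPk archSub Ψ act Mmod region n lat sig split qData tq t htq0 htq1).qRegion j (.inr pp) ⊆
      (settingDHVolSharp X hlog M archPk archSub Ψ act Mmod region n lat sig split qData tq t htq0 htq1).thetaHull j (.inr pp) := by
  -- adapted from abc-iut-w5-d180's `qRegion_subset_thetaHull_settingDHVolSharp_of_slotMovers` (p439967): one image PER summand,
  -- preceded by a factor permutation from (Ind1)
  haveI : Fact (pp : ℕ).Prime := ⟨pp.2⟩
  classical
  set P := settingDHVolSharp X hlog M archPk archSub Ψ act Mmod region n lat sig split qData tq t htq0 htq1 with hP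
  show factorMapDH X hlog j (.inr pp) ⁻¹' hullSet (factorFieldDH X hlog j (.inr pp)) (qCentreDH X hlog tq j (.inr pp)) ⊆
    (HullFrame.ofComparison (factorFieldDH X hlog j (.inr pp)) (factorMapDH X hlog j (.inr pp))).hull (⋃₀ P.possibleImages j (.inr pp))
  refine HullFrame.preimage_hullSet_subset_hull_ofComparison (factorFieldDH X hlog j (.inr pp))
    (factorMapDH X hlog j (.inr pp)) _ _ ?_
  set L := logShellsDH X logv with hL
  set Pr := presAt X hlog pp with hPr
  -- the point `x₀ = 1 ⊗ ⋯ ⊗ 1 ⊗ t_{Θ,j,v_j}` of the Θ-box at every summand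
  let y : (thetaIndex X).Caps j → L.Packet1 (.inr pp) := fun a x =>
    (Pr.φ x).symm (Pi.mulSingle (M := fun _ : (thetaIndex X).Caps j => Pr.k x) (Fin.last _) (labelIdele X t pp j x) a)
  let x₀ : L.Packet j (.inr pp) := PiTensorProduct.tprod ℚ y
  have hcmp : ∀ e : (thetaIndex X).Caps j → (thetaIndex X).Fibre (.inr pp),
      Pr.comparison j x₀ e = iota pp.1 (Pr.kk e) (Fin.last _) (labelIdele X t pp j (e (Fin.last _))) := by
    intro e
    rw [Pr.comparison_tprod, iota_eq_purePacket]
    refine congrArg (PiTensorProduct.tprod ℚ_[pp]) (funext fun a => ?_)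
    rcases eq_or_ne a (Fin.last _) with rfl | ha
    · simp [y]
    · simp [y, Pi.mulSingle_eq_of_ne ha]
  have hx₀ : x₀ ∈ P.thetaRegion3 j (.inr pp) := by
    rw [hP, settingDHVolSharp, thetaRegion3_thetaBoxDH]
    show (fun z => Pr.factorMap j z) x₀ ∈ Pr.boxOf (sharpBoxDH X hlog t pp j)
    intro e
    refine ⟨Pr.comparison j x₀ e, ?_, fun i => rfl⟩
    rw [hcmp e]
    exact ⟨1, Subring.one_mem _, mul_one _⟩
  rintro ⟨e, i⟩
  obtain ⟨σ, G, hG, hGn⟩ := hmov e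
  -- the (Ind2)-family of the movers
  obtain ⟨Φ₂, hΦ₂, hΦ₂j⟩ := L.exists_mem_Ind2Family_apply_eq
    (show L.factorwise j (.inr pp) (fun a => L.summandwise (.inr pp) (G a)) ∈ L.Ind2 j (.inr pp) from
      ⟨G, fun a x => hG a x, rfl⟩)
  -- the (Ind1)-family permuting the factors by `σ` at the label `j` (identity at the other labels)
  let Φ₁ : L.PacketAut := Function.update (fun j' vQ' => LinearEquiv.refl ℚ (L.Packet j' vQ')) j fun vQ' => L.permute j vQ' σ
  have hΦ₁j : Φ₁ j = fun vQ' => L.permute j vQ' σ := Function.update_self ..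
  have hΦ₁ : Φ₁ ∈ L.Ind1Family := by
    intro j'
    by_cases hj : j' = j
    · subst hj
      rw [show (fun vQ => Φ₁ j' vQ) = fun vQ' => L.permute j' vQ' σ from hΦ₁j]
      refine ⟨σ, fun _ v => LinearEquiv.refl ℚ (L.carrier v), fun _ v => L.one_mem_stripAut v, fun vQ => ?_⟩
      rw [L.summandwise_refl_family, L.factorwise_refl]
      exact (LinearEquiv.trans_refl _).symm
    · have h' : Φ₁ j' = fun vQ' => LinearEquiv.refl ℚ (L.Packet j' vQ') := Function.update_of_ne hj _ _
      rw [show (fun vQ => Φ₁ j' vQ) = Φ₁ j' from rfl, h']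
      exact L.refl_mem_Ind1 j'
  have hΦind : Φ₂ * Φ₁ ∈ Setting.indGroup (situationDHVol X hlog M archPk archSub Ψ act Mmod region) :=
    Subgroup.mul_mem _ (Subgroup.subset_closure (Or.inr hΦ₂)) (Subgroup.subset_closure (Or.inl hΦ₁))
  -- the image point: a pure tensor with slot components `g_{a,v_a}(y_{σ⁻¹(a)})`
  have hu : (Φ₂ * Φ₁) j (.inr pp) x₀ ∈ ⋃₀ P.possibleImages j (.inr pp) :=
    Set.mem_sUnion.2 ⟨_, ⟨Φ₂ * Φ₁, hΦind, rfl⟩, Set.mem_image_of_mem _ hx₀⟩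
  let yσ : (thetaIndex X).Caps j → L.Packet1 (.inr pp) := fun a => y (σ.symm a)
  let y' : (thetaIndex X).Caps j → L.Packet1 (.inr pp) := fun a x => G a x (yσ a x)
  have hpt : (Φ₂ * Φ₁) j (.inr pp) x₀ = PiTensorProduct.tprod ℚ y' := by
    show Φ₂ j (.inr pp) (Φ₁ j (.inr pp) x₀) = _
    rw [show Φ₁ j (.inr pp) = L.permute j (.inr pp) σ from congrFun hΦ₁j (.inr pp), hΦ₂j]
    have h1 : L.permute j (.inr pp) σ x₀ = PiTensorProduct.tprod ℚ yσ := L.permute_tprod j (.inr pp) σ y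
    rw [h1]
    exact PiTensorProduct.congr_tprod (fun a => L.summandwise (.inr pp) (G a)) yσ
  have hcmp' : Pr.comparison j ((Φ₂ * Φ₁) j (.inr pp) x₀) e =
      purePacket pp.1 (Pr.kk e) fun a => Pr.φ (e a) (G a (e a) (y (σ.symm a) (e a))) := by
    rw [hpt, Pr.comparison_tprod]
    rfl
  refine ⟨(Φ₂ * Φ₁) j (.inr pp) x₀, hu, ?_⟩
  show ‖dEquiv pp.1 (Pr.kk e) (iota pp.1 (Pr.kk e) (Fin.last _) (tq pp (e (Fin.last _)))) i‖ ≤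
    ‖dEquiv pp.1 (Pr.kk e) (Pr.comparison j ((Φ₂ * Φ₁) j (.inr pp) x₀) e) i‖
  rw [hcmp', norm_dEquiv_iota, NonIsometryMover.norm_dEquiv_purePacket]
  exact hGn

/-! ## 2. Two targets and a slot choice per summand -/

/-- **q-region ⊆ Θ-hull at `(j, p)` from TWO TARGET FUNCTIONS AND A SLOT CHOICE.** If at every place `x | p` some `g₁ ∈ Ism_x` moves
`1` to norm `≥ R_x ≥ 0` and some `g₂ ∈ Ism_x` moves `t_{Θ,j,x}` to norm `≥ N_x ≥ 0`, and for every tuple `v⃗ = (v_0, …, v_j)` a slot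
`s(v⃗)` is chosen with `‖t_{q,v_j}‖ ≤ N_{v_{s(v⃗)}}·Π_{a ≠ s(v⃗)} R_{v_a}` (written as one product of `if a = s(v⃗) then N else R`), then
`q-region ⊆ ⁿ˒°𝒰_{j,p}`: the Θ-idele is carried by the slot `s(v⃗)` (at the place `v_{s(v⃗)}`) and every other slot, INCLUDING the last,
donates `R`. abc-iut-w5-d180's `…_of_targets` is the constant choice `s = last`. [cite: Mochizuki2012, IUTchIII Thm. 3.11 (i) p. 154]
[cite: DupuyHilado2025, §3.9, §4.7, §4.9] [claim: Mochizuki2012, status: disputed] -/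
theorem qRegion_subset_thetaHull_settingDHVolSharp_of_permTargets (j : (thetaIndex X).Label) (pp : Nat.Primes)
    (R Nn : (thetaIndex X).Fibre (.inr pp) → ℝ) (hR0 : ∀ x, 0 ≤ R x) (hN0 : ∀ x, 0 ≤ Nn x)
    (hR : haveI : Fact (pp : ℕ).Prime := ⟨pp.2⟩
      ∀ x : (thetaIndex X).Fibre (.inr pp), ∃ g ∈ ismDH logv x.1,
        R x ≤ ‖(presAt X hlog pp).φ x (g (((presAt X hlog pp).φ x).symm 1))‖)
    (hN : haveI : Fact (pp : ℕ).Prime := ⟨pp.2⟩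
      ∀ x : (thetaIndex X).Fibre (.inr pp), ∃ g ∈ ismDH logv x.1,
        Nn x ≤ ‖(presAt X hlog pp).φ x (g (((presAt X hlog pp).φ x).symm (labelIdele X t pp j x)))‖)
    (s : ((thetaIndex X).Caps j → (thetaIndex X).Fibre (.inr pp)) → (thetaIndex X).Caps j)
    (hle : haveI : Fact (pp : ℕ).Prime := ⟨pp.2⟩
      ∀ e : (thetaIndex X).Caps j → (thetaIndex X).Fibre (.inr pp),
        ‖tq pp (e (Fin.last _))‖ ≤ ∏ a, (if a = s e then Nn (e a) else R (e a))) :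
    (settingDHVolSharp X hlog M archPk archSub Ψ act Mmod region n lat sig split qData tq t htq0 htq1).qRegion j (.inr pp) ⊆
      (settingDHVolSharp X hlog M archPk archSub Ψ act Mmod region n lat sig split qData tq t htq0 htq1).thetaHull j (.inr pp) := by
  haveI : Fact (pp : ℕ).Prime := ⟨pp.2⟩
  classical
  choose g₁ hg₁ hg₁n using hR
  choose g₂ hg₂ hg₂n using hN
  refine qRegion_subset_thetaHull_settingDHVolSharp_of_permSlotMovers X hlog M archPk archSub Ψ act Mmod region n lat sig split qData
    tq t htq0 htq1 j pp fun e => ⟨Equiv.swap (s e) (Fin.last _), fun a x => if a = s e then g₂ x else g₁ x, fun a x => ?_, ?_⟩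
  · by_cases ha : a = s e
    · simp only [ha, if_true]; exact hg₂ x
    · simp only [if_neg ha]; exact hg₁ x
  · refine (hle e).trans (Finset.prod_le_prod (fun a _ => by split_ifs <;> first | exact hN0 _ | exact hR0 _) fun a _ => ?_)
    have hsymm : (Equiv.swap (s e) (Fin.last _)).symm a = Equiv.swap (s e) (Fin.last _) a := by rw [Equiv.symm_swap]
    by_cases ha : a = s e
    · -- the chosen slot carries the Θ-idele
      subst ha
      dsimp only
      rw [if_pos rfl, if_pos rfl, hsymm, Equiv.swap_apply_left, Pi.mulSingle_eq_same]
      exact hg₂n (e (s e))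
    · -- every other slot carries `1`
      have hne : Equiv.swap (s e) (Fin.last _) a ≠ Fin.last _ := by
        intro h
        have : a = s e := by
          have h' := congrArg (Equiv.swap (s e) (Fin.last _)) h
          rw [Equiv.swap_apply_self, Equiv.swap_apply_right] at h'
          exact h'
        exact ha this
      dsimp only
      rw [if_neg ha, if_neg ha, hsymm, Pi.mulSingle_eq_of_ne hne]
      exact hg₁n (e a)

end Summit.ABC.IUTFork.Thm311.Real

end
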